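import Summits.HodgeConjecture.HodgeConjecture.Theses.PadicSemiregularLift
import Literature.AlgebraicGeometry.HodgeTheory.SemiregularityObstructionBridge

/-!
# `PadicPridhamSemiregularity` (stmt-HodgeConjecture-13815) · Negative · line B's step datum reduces to additivity

Negative-side knowledge for the informal crux `PadicSemiregularLift.PadicPridhamSemiregularity` (P1b),
extracted from the standing disprover's work file `Cruxes/PadicPridhamSemiregularity/Disproof.lean` §10
(refuter-cdisprove-stmt-HodgeConjecture-13815-g3-0, cycle 3, 2026-08-16 — the TARGETS audit of the two
registered skeletons of the crux).

Line B (`Cruxes/…/Lines/crystalline-abel-jacobi.lean`) registers two ∃-stubs `stub_firstStep` (`n = 0`) and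
`stub_deepSteps` (`n ≥ 1`) whose common body is the one-step datum `HasStepDatum 𝒳 E₁ hE₁ n`: homomorphisms
`δ₀, δ₁` on `im(K₀(X_{n+1}) → K₀(X₁))` killing the classes restricted from `K₀(X_{n+2})`, an obstruction
`ob` with Illusie's lifting criterion, and `δᵢ[E₁] = εᵢ • σᵢ(ob F)` for every lift `F` (intended `δ` =
the NORMALISED Hodge defect of the crystalline Chern character). `hasStepDatum_of_additivePackage` proves
that body — stated VERBATIM as the conclusion — from an obstruction map at the step with the lifting
criterion (B) and additivity (A₀), (A₁) of the real `σ₀ ∘ Ob`, `σ₁ ∘ Ob` (= line A's stub H of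
`Lines/sigma-ob-kzero-additivity.lean` instantiated at the step), naturality of the real `σ₀`, `σ₁` under
isomorphisms, and the kernel condition "the `K₀`-factorised `σᵢ ∘ Ob` kill `ker(K₀(X_{n+1}) → K₀(X_k))`",
which is AUTOMATIC at `n = 0` (`Negative/SpecialFibreIso.lean`: `X_k ⟶ X₁` is an isomorphism for perfect
`k`, `kZero_map_specialFibreToThickening_zero_injective`) and is where Hodge-torsion-freeness
enters for `n ≥ 1`. Consequently the ∃-typed stubs of line B carry no crystalline content (they never
mention `ch^cris`): the crystalline Abel–Jacobi identity is docstring-only there, and `stub_firstStep`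
needs none of `H_tf`, projectivity, `p ≠ 2`, `d < p`. Companion files: `Negative/StubAudit.lean`,
`Negative/SpecialFibreIso.lean`.
-/

noncomputable section

namespace Summit.HodgeConjecture.HodgeConjecture.Theorems.PadicPridhamSemiregularity.Negative

open CategoryTheory CategoryTheory.Limits AlgebraicGeometry
open Literature.AlgebraicGeometry.KTheory Literature.AlgebraicGeometry.Motives
  Literature.AlgebraicGeometry.Motives.WittScheme Literature.AlgebraicGeometry.HodgeTheory
  Literature.AlgebraicGeometry.Deformation Literature.AlgebraicGeometry.Modules

universe u

/-- Descending an additive map along a homomorphism onto its range, given that it kills the kernel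
(first isomorphism theorem, elementary form). [folklore] -/
theorem exists_descendToRange {G H A : Type*} [AddCommGroup G] [AddCommGroup H] [AddCommGroup A]
    (f : G →+ H) (Φ : G →+ A) (hΦ : ∀ z, f z = 0 → Φ z = 0) :
    ∃ δ : f.range →+ A, ∀ (z : G) (x : f.range), (x : H) = f z → δ x = Φ z := by
  have hwd : ∀ (x : f.range) (z : G), (x : H) = f z →
      Φ (Classical.choose (AddMonoidHom.mem_range.mp x.2)) = Φ z := by
    intro x z hx
    have h := Classical.choose_spec (AddMonoidHom.mem_range.mp x.2)
    have h0 : f (Classical.choose (AddMonoidHom.mem_range.mp x.2) - z) = 0 := by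
      rw [map_sub, h, hx, sub_self]
    have h1 := hΦ _ h0
    rwa [map_sub, sub_eq_zero] at h1
  refine ⟨{ toFun := fun x => Φ (Classical.choose (AddMonoidHom.mem_range.mp x.2))
            map_zero' := ?_
            map_add' := ?_ }, fun z x hx => hwd x z hx⟩
  · rw [hwd 0 0 (by rw [map_zero]; rfl), map_zero]
  · intro x y
    rw [hwd (x + y) (Classical.choose (AddMonoidHom.mem_range.mp x.2) +
        Classical.choose (AddMonoidHom.mem_range.mp y.2)) (by
          rw [map_add, Classical.choose_spec (AddMonoidHom.mem_range.mp x.2),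
            Classical.choose_spec (AddMonoidHom.mem_range.mp y.2)]
          rfl), map_add]

section Witt

variable {p : ℕ} [Fact p.Prime] {k : Type} [Field k] [CharP k p]

/-! ## The reduction: line B's one-step datum from line A's additivity package -/

/-- **REDUCTION THEOREM.** The one-step ∃-datum of line B (`HasStepDatum 𝒳 E₁ hE₁ n`, stated here as the
conclusion VERBATIM) follows — with no torsion-freeness, projectivity, `p ≠ 2`, `d < p` or crystalline
Chern character — from: an obstruction map `Ob` at the step `X_{n+1} ⊂ X_{n+2}` read on `X_k` with the
lifting criterion `hB` and additivity `hA₀`, `hA₁` of the real `σ₀ ∘ Ob`, `σ₁ ∘ Ob` (line A's stub H at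
the step), naturality `hN` of `σ₀`, `σ₁` under the identifications `α : F|X_k ≅ E₁`, and the kernel
condition `hker` (the `K₀`-factorised `σᵢ ∘ Ob` kill `ker(K₀(X_{n+1}) → K₀(X_k))`; automatic at `n = 0`,
`kZero_map_specialFibreToThickening_zero_injective`; for `n ≥ 1` it is where Hodge-torsion-freeness enters).
The tower identity `hcomp : (X_k ⟶ X_{n+1} ⟶ X_{n+2}) = (X_k ⟶ X_{n+2})` is carried as a hypothesis: it holds for
every `𝒳` (`pullback.hom_ext`; line B §5 / Disproof.lean §10 `specialFibreToThickening_comp_thickeningMap'`,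
whose proof needs the `backward.isDefEq.respectTransparency` override, as does Mathlib's own
`pullback.map_comp` does). Witness:
`δᵢ :=` the `K₀`-factorised `σᵢ ∘ Ob` descended to the image, `ob := α_*Ob`, `ε₀ = ε₁ = 1`. [folklore] -/
theorem hasStepDatum_of_additivePackage (𝒳 : SchemeOver (WittVector p k)) (n : ℕ)
    (hcomp : specialFibreToThickening 𝒳 n ≫ thickeningMap 𝒳 (Nat.le_succ (n + 1)) =
      specialFibreToThickening 𝒳 (n + 1))
    (Ob : ∀ (F : (WittScheme.thickening 𝒳 (n + 1)).left.Modules), IsFiniteLocallyFree F →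
      obstructionGroup 2 ((Scheme.Modules.pullback (specialFibreToThickening 𝒳 n)).obj F)
        (unitModule (specialFibre 𝒳).left))
    (hB : ∀ (F : (WittScheme.thickening 𝒳 (n + 1)).left.Modules) (hF : IsFiniteLocallyFree F),
      Ob F hF = 0 ↔ ∃ F' : (WittScheme.thickening 𝒳 (n + 2)).left.Modules, IsFiniteLocallyFree F' ∧
        Nonempty ((Scheme.Modules.pullback (thickeningMap 𝒳 (Nat.le_succ (n + 1)))).obj F' ≅ F))
    (hA₀ : ∀ (S : ShortComplex (WittScheme.thickening 𝒳 (n + 1)).left.Modules), S.ShortExact →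
      ∀ (h₁ : IsFiniteLocallyFree S.X₁) (h₂ : IsFiniteLocallyFree S.X₂) (h₃ : IsFiniteLocallyFree S.X₃),
        sigmaZeroObstruction (h₂.pullback (specialFibreToThickening 𝒳 n)) (Ob S.X₂ h₂) =
          sigmaZeroObstruction (h₁.pullback (specialFibreToThickening 𝒳 n)) (Ob S.X₁ h₁) +
            sigmaZeroObstruction (h₃.pullback (specialFibreToThickening 𝒳 n)) (Ob S.X₃ h₃))
    (hA₁ : ∀ (S : ShortComplex (WittScheme.thickening 𝒳 (n + 1)).left.Modules), S.ShortExact →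
      ∀ (h₁ : IsFiniteLocallyFree S.X₁) (h₂ : IsFiniteLocallyFree S.X₂) (h₃ : IsFiniteLocallyFree S.X₃),
        sigmaOneObstruction (h₂.pullback (specialFibreToThickening 𝒳 n)) (Ob S.X₂ h₂) =
          sigmaOneObstruction (h₁.pullback (specialFibreToThickening 𝒳 n)) (Ob S.X₁ h₁) +
            sigmaOneObstruction (h₃.pullback (specialFibreToThickening 𝒳 n)) (Ob S.X₃ h₃))
    (hN : ∀ (F : (WittScheme.thickening 𝒳 (n + 1)).left.Modules) (hF : IsFiniteLocallyFree F)
      (E₁ : (specialFibre 𝒳).left.Modules) (hE₁ : IsFiniteLocallyFree E₁)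
      (α : (Scheme.Modules.pullback (specialFibreToThickening 𝒳 n)).obj F ≅ E₁)
      (x : obstructionGroup 2 ((Scheme.Modules.pullback (specialFibreToThickening 𝒳 n)).obj F)
        (unitModule (specialFibre 𝒳).left)),
      sigmaZeroObstruction hE₁ (obstructionGroupCongr 2 α (unitModule (specialFibre 𝒳).left) x) =
          sigmaZeroObstruction (hF.pullback (specialFibreToThickening 𝒳 n)) x ∧
        sigmaOneObstruction hE₁ (obstructionGroupCongr 2 α (unitModule (specialFibre 𝒳).left) x) =
          sigmaOneObstruction (hF.pullback (specialFibreToThickening 𝒳 n)) x)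
    (hker : ∀ z : KZero (WittScheme.thickening 𝒳 (n + 1)).left,
      KZero.map (specialFibreToThickening 𝒳 n) z = 0 →
        KZero.lift (fun F hF => sigmaZeroObstruction (hF.pullback (specialFibreToThickening 𝒳 n))
          (Ob F hF)) hA₀ z = 0 ∧
        KZero.lift (fun F hF => sigmaOneObstruction (hF.pullback (specialFibreToThickening 𝒳 n))
          (Ob F hF)) hA₁ z = 0)
    (E₁ : (specialFibre 𝒳).left.Modules) (hE₁ : IsFiniteLocallyFree E₁) :
    ∃ (δ₀ : (KZero.map (specialFibreToThickening 𝒳 n)).range →+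
          structureSheafCohomology (specialFibre 𝒳).left 2)
      (δ₁ : (KZero.map (specialFibreToThickening 𝒳 n)).range →+ hodgeCohomologyOne (specialFibre 𝒳) 3)
      (ob : ∀ (F : (WittScheme.thickening 𝒳 (n + 1)).left.Modules), IsFiniteLocallyFree F →
          ((Scheme.Modules.pullback (specialFibreToThickening 𝒳 n)).obj F ≅ E₁) →
          obstructionGroup 2 E₁ (unitModule (specialFibre 𝒳).left))
      (ε₀ ε₁ : ℤˣ),
      (∀ x : (KZero.map (specialFibreToThickening 𝒳 n)).range,
        (∃ y : KZero (WittScheme.thickening 𝒳 (n + 2)).left,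
          KZero.map (specialFibreToThickening 𝒳 (n + 1)) y = x.1) → δ₀ x = 0 ∧ δ₁ x = 0) ∧
      (∀ (F : (WittScheme.thickening 𝒳 (n + 1)).left.Modules) (hF : IsFiniteLocallyFree F)
          (α : (Scheme.Modules.pullback (specialFibreToThickening 𝒳 n)).obj F ≅ E₁),
        ob F hF α = 0 ↔ ∃ F' : (WittScheme.thickening 𝒳 (n + 2)).left.Modules, IsFiniteLocallyFree F' ∧
          Nonempty ((Scheme.Modules.pullback (thickeningMap 𝒳 (Nat.le_succ (n + 1)))).obj F' ≅ F)) ∧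
      (∀ (F : (WittScheme.thickening 𝒳 (n + 1)).left.Modules) (hF : IsFiniteLocallyFree F)
          (α : (Scheme.Modules.pullback (specialFibreToThickening 𝒳 n)).obj F ≅ E₁)
          (hx : KZero.of E₁ hE₁ ∈ (KZero.map (specialFibreToThickening 𝒳 n)).range),
        δ₀ ⟨KZero.of E₁ hE₁, hx⟩ = ε₀ • sigmaZeroObstruction hE₁ (ob F hF α) ∧
        δ₁ ⟨KZero.of E₁ hE₁, hx⟩ = ε₁ • sigmaOneObstruction hE₁ (ob F hF α)) := by
  -- `Σᵢ[F] = σᵢ(Ob F)` for the `K₀`-factorised invariants (Disproof §1 Finding 1, on real `σ₀`, `σ₁`)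
  have hS0_of : ∀ (F : (WittScheme.thickening 𝒳 (n + 1)).left.Modules) (hF : IsFiniteLocallyFree F),
      KZero.lift (fun F hF => sigmaZeroObstruction (hF.pullback (specialFibreToThickening 𝒳 n))
        (Ob F hF)) hA₀ (KZero.of F hF) =
        sigmaZeroObstruction (hF.pullback (specialFibreToThickening 𝒳 n)) (Ob F hF) := fun F hF =>
    KZero.lift_of _ _ F hF
  have hS1_of : ∀ (F : (WittScheme.thickening 𝒳 (n + 1)).left.Modules) (hF : IsFiniteLocallyFree F),
      KZero.lift (fun F hF => sigmaOneObstruction (hF.pullback (specialFibreToThickening 𝒳 n))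
        (Ob F hF)) hA₁ (KZero.of F hF) =
        sigmaOneObstruction (hF.pullback (specialFibreToThickening 𝒳 n)) (Ob F hF) := fun F hF =>
    KZero.lift_of _ _ F hF
  -- `Σᵢ` kills the classes restricted from `X_{n+2}` (Finding 1 (B))
  have hS0_map : ∀ y : KZero (WittScheme.thickening 𝒳 (n + 2)).left,
      KZero.lift (fun F hF => sigmaZeroObstruction (hF.pullback (specialFibreToThickening 𝒳 n))
        (Ob F hF)) hA₀ (KZero.map (thickeningMap 𝒳 (Nat.le_succ (n + 1))) y) = 0 := by
    intro y
    have hcomp : (KZero.lift (fun F hF => sigmaZeroObstruction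
        (hF.pullback (specialFibreToThickening 𝒳 n)) (Ob F hF)) hA₀).comp
          (KZero.map (thickeningMap 𝒳 (Nat.le_succ (n + 1)))) = 0 :=
      KZero.hom_ext fun G hG => by
        rw [AddMonoidHom.comp_apply, KZero.map_of, KZero.lift_of, (hB _ _).2 ⟨G, hG, ⟨Iso.refl _⟩⟩,
          map_zero, AddMonoidHom.zero_apply]
    have h := DFunLike.congr_fun hcomp y
    rwa [AddMonoidHom.comp_apply, AddMonoidHom.zero_apply] at h
  have hS1_map : ∀ y : KZero (WittScheme.thickening 𝒳 (n + 2)).left,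
      KZero.lift (fun F hF => sigmaOneObstruction (hF.pullback (specialFibreToThickening 𝒳 n))
        (Ob F hF)) hA₁ (KZero.map (thickeningMap 𝒳 (Nat.le_succ (n + 1))) y) = 0 := by
    intro y
    have hcomp : (KZero.lift (fun F hF => sigmaOneObstruction
        (hF.pullback (specialFibreToThickening 𝒳 n)) (Ob F hF)) hA₁).comp
          (KZero.map (thickeningMap 𝒳 (Nat.le_succ (n + 1)))) = 0 :=
      KZero.hom_ext fun G hG => by
        rw [AddMonoidHom.comp_apply, KZero.map_of, KZero.lift_of, (hB _ _).2 ⟨G, hG, ⟨Iso.refl _⟩⟩,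
          map_zero, AddMonoidHom.zero_apply]
    have h := DFunLike.congr_fun hcomp y
    rwa [AddMonoidHom.comp_apply, AddMonoidHom.zero_apply] at h
  -- the descended homomorphisms `δ₀`, `δ₁`
  obtain ⟨δ₀, hδ₀⟩ := exists_descendToRange (KZero.map (specialFibreToThickening 𝒳 n))
    (KZero.lift (fun F hF => sigmaZeroObstruction (hF.pullback (specialFibreToThickening 𝒳 n))
      (Ob F hF)) hA₀) (fun z hz => (hker z hz).1)
  obtain ⟨δ₁, hδ₁⟩ := exists_descendToRange (KZero.map (specialFibreToThickening 𝒳 n))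
    (KZero.lift (fun F hF => sigmaOneObstruction (hF.pullback (specialFibreToThickening 𝒳 n))
      (Ob F hF)) hA₁) (fun z hz => (hker z hz).2)
  refine ⟨δ₀, δ₁, fun F hF α => obstructionGroupCongr 2 α (unitModule (specialFibre 𝒳).left) (Ob F hF),
    1, 1, ?_, ?_, ?_⟩
  · -- (V)
    rintro x ⟨y, hy⟩
    have hx : (x : KZero (specialFibre 𝒳).left) = KZero.map (specialFibreToThickening 𝒳 n)
        (KZero.map (thickeningMap 𝒳 (Nat.le_succ (n + 1))) y) := by
      rw [← KZero.map_comp_apply, hcomp, hy]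
    exact ⟨by rw [hδ₀ _ x hx]; exact hS0_map y, by rw [hδ₁ _ x hx]; exact hS1_map y⟩
  · -- (OB)
    intro F hF α
    rw [AddEquiv.map_eq_zero_iff]
    exact hB F hF
  · -- (ID)
    intro F hF α hx
    have hcls : (KZero.of E₁ hE₁ : KZero (specialFibre 𝒳).left) =
        KZero.map (specialFibreToThickening 𝒳 n) (KZero.of F hF) := by
      rw [KZero.map_of]
      exact (KZero.of_iso α _ _).symm
    obtain ⟨hN0, hN1⟩ := hN F hF E₁ hE₁ α (Ob F hF)
    refine ⟨?_, ?_⟩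
    · rw [hδ₀ (KZero.of F hF) _ hcls, hS0_of, one_smul, hN0]
    · rw [hδ₁ (KZero.of F hF) _ hcls, hS1_of, one_smul, hN1]

end Witt

end Summit.HodgeConjecture.HodgeConjecture.Theorems.PadicPridhamSemiregularity.Negative

end
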